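import Summits.BirchSwinnertonDyer.BirchSwinnertonDyer.Theorems.ManinLocalTwoThreeDegeneracyUnitTwistSquarefull
import Summits.BirchSwinnertonDyer.Rank1Residual.ManinAdditive.KatoCurvePlusDefectProofs
import HarnessLib

/-!
# THEOREM U at KATO'S CURVE `E_K`: the ratio-`9` degeneracy polar witness transported along `Ω(W) ∣₃ Ω(E_K)` (E-es-63, PROVED)
# — `3 ∤ c(W)` at squarefull level with NO PLUS DEFECT, for EVERY `W` (reducible `W[3]` included), modulo F-es-18♭K

Summit `BirchSwinnertonDyer`, route `ManinLocalTwoThree` (cell bsd-f2-manin), crux C3 `ManinPrimeToThreeAtNine`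
(stmt-BirchSwinnertonDyer-22968).  Sequel of `…DegeneracyUnitTwistSquarefull`.  On the `W[3]`-REDUCIBLE locus Kato's fact is
available only at Kato's own curve `E_K = ℂ/𝓛̄_f` of the class (`IsSymbolClosureCurve VK D.f`; the Literature fact F-es-18♭K
`kato_isIntegral_twistedSymbolSum_three_symbolClosure`), so a witness against `Ω(W)` must be read THROUGH `E_K`: the tree's
one-sided transfer `threeAdicPolarWitness_of_periodDividesAt` does this as soon as `Ω(W) ∣₃ Ω(E_K)` (`PeriodDividesAt 3 VK W`),
which is es's THEOREM E-es-63 `katoCurvePeriodDvdOfNoPlusDefect_holds` on the locus of NO PLUS DEFECT at `3`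
(`CuspidalPlusDefectPrimeTo 3 D`).  Feeding the transfer with this seat's class-blind witness
`threeAdicPolarWitness_of_degeneracyNinePlusIndex` (THEOREM U (b): ratio-`9` degeneracy plus index, POLAR clause `χ(3) ∉ {±1}`,
so NO Kosters–Pannekoek class enters and the transport to `E_K` is clause-free) gives:

* `threeAdicPolarWitness_katoCurve_of_degeneracyNinePlusIndex` — the witness `ThreeAdicPolarWitness W VK D.f` at Kato's curve;
* `not_three_dvd_maninConstant_of_degeneracyNinePlusIndex_symbolClosure` — **`3 ∤ D.c`** for every lattice-optimal datum of a
  globally minimal `W` additive at `3` at a squarefull level `9 ∣ N` with no plus defect at `3`, whose newform has ratio-`9`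
  degeneracy plus index prime to `3`, modulo F-es-18♭K (and the inhabitation of Kato's curve `VK`, S-es-K, supplied as binders
  exactly as in the tree's `not_three_dvd_maninConstant_of_noPlusDefect`);
* `not_three_dvd_maninConstant_of_degeneracyLoopLawNine_symbolClosure` — the same from the lattice law E-es-68₉ and the Shimura
  plus index `PlusIndexPrimeTo 3 D.f` (composite squarefull: discharged by `plusIndexPrimeTo_three_of_sq_dvd`, variant `'`).
Compared with the tree's `not_three_dvd_maninConstant_of_noPlusDefect` (F-es-18♭K + LAW E-es-61 + «no short `3`-torsion» + no
plus defect), the law E-es-61 and the torsion hypothesis are REPLACED by the E-blind lattice law E-es-68₉ (or the f-specific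
ratio-`9` index) on the squarefull locus.

HONEST FRAMING: CONDITIONAL (F-es-18♭K is a derived reading of Kato filed as a Literature `def`; E-es-68₉ is a typed lattice law;
`VK` is a binder).  C3, Manin's conjecture and BSD are NOT proved by this.  No definitions, no named facts, no sorry.
-/

set_option linter.dupNamespace false
set_option autoImplicit false

noncomputable section

open scoped Classical MatrixGroups ModularForm ComplexConjugate

open CongruenceSubgroup Complex Literature.NumberTheory.EllipticCurves
  Literature.NumberTheory.EllipticCurves.ModularForms
  Summit.BirchSwinnertonDyer.Rank1Residual.ManinAdditive.Gamma1Lattice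
  Summit.BirchSwinnertonDyer.Rank1Residual.ManinAdditive.KatoCurve

namespace Summit.BirchSwinnertonDyer.BirchSwinnertonDyer.Theorems.ManinLocalTwoThree

/-- **THEOREM U (b) read at Kato's curve.**  The ratio-`9` degeneracy polar witness of `W` transported along
`Ω(W) ∣₃ Ω(E_K)` (E-es-63 on the no-plus-defect locus): `ThreeAdicPolarWitness W VK D.f` for Kato's curve `VK` of the class. -/
theorem threeAdicPolarWitness_katoCurve_of_degeneracyNinePlusIndex
    (W : WeierstrassCurve ℚ) [W.IsElliptic] [W.IsGloballyMinimal] {N : ℕ} [NeZero N] (D : ModularParametrizationData W N)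
    (hadd : ¬ W.HasGoodReductionAtPrime 3 ∧ ¬ W.HasMultiplicativeReductionAtPrime 3)
    (hopt : ∀ z ∈ D.L.lattice, ∃ w ∈ periodLattice D.f, z = D.c * w)
    (h9 : 3 ^ 2 ∣ N) (hsq : ∀ ℓ ∈ N.primeFactors, ℓ ^ 2 ∣ N)
    (hd : ∀ x ∈ periodLattice D.f, ∃ y ∈ AddSubgroup.closure (degeneracyLoops D.f 9), ∃ k : ℕ, ¬ 3 ∣ k ∧
      (k : ℂ) * (x + conj x) = y + conj y)
    (hpd : CuspidalPlusDefectPrimeTo 3 D)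
    (VK : WeierstrassCurve ℚ) [VK.IsElliptic] [VK.IsGloballyMinimal] (hiso : WeierstrassCurve.IsIsogenous W VK)
    (hK : IsSymbolClosureCurve VK D.f) (hnewK : IsNewformOf VK D.f) (hgK : ¬ VK.HasGoodReductionAtPrime 3)
    (hmK : ¬ VK.HasMultiplicativeReductionAtPrime 3) (haK : ∀ ℓ : ℕ, VK.LFunction ℓ = W.LFunction ℓ) :
    ThreeAdicPolarWitness W VK D.f :=
  threeAdicPolarWitness_of_periodDividesAt W VK W D.f
    (threeAdicPolarWitness_of_degeneracyNinePlusIndex W D hadd h9 hsq hd)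
    (katoCurvePeriodDvdOfNoPlusDefect_holds 3 W D hopt hpd VK hiso hK) hnewK hgK hmK haK

/-- **`3 ∤ c(W)` at squarefull level with NO PLUS DEFECT, class-blind, reducible `W[3]` allowed**, modulo F-es-18♭K: from
the f-specific ratio-`9` degeneracy plus index of `D.f`. CONDITIONAL. [cite: Kato2004Asterisque, Thm. 12.5 (1) (p. 221)] -/
theorem not_three_dvd_maninConstant_of_degeneracyNinePlusIndex_symbolClosure
    (hF : kato_isIntegral_twistedSymbolSum_three_symbolClosure)
    (W : WeierstrassCurve ℚ) [W.IsElliptic] [W.IsGloballyMinimal] {N : ℕ} [NeZero N] (D : ModularParametrizationData W N)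
    (hadd : ¬ W.HasGoodReductionAtPrime 3 ∧ ¬ W.HasMultiplicativeReductionAtPrime 3)
    (hopt : ∀ z ∈ D.L.lattice, ∃ w ∈ periodLattice D.f, z = D.c * w)
    (h9 : 3 ^ 2 ∣ N) (hsq : ∀ ℓ ∈ N.primeFactors, ℓ ^ 2 ∣ N)
    (hd : ∀ x ∈ periodLattice D.f, ∃ y ∈ AddSubgroup.closure (degeneracyLoops D.f 9), ∃ k : ℕ, ¬ 3 ∣ k ∧
      (k : ℂ) * (x + conj x) = y + conj y)
    (hpd : CuspidalPlusDefectPrimeTo 3 D)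
    (VK : WeierstrassCurve ℚ) [VK.IsElliptic] [VK.IsGloballyMinimal] (hiso : WeierstrassCurve.IsIsogenous W VK)
    (hK : IsSymbolClosureCurve VK D.f) (hnewK : IsNewformOf VK D.f) (hgK : ¬ VK.HasGoodReductionAtPrime 3)
    (hmK : ¬ VK.HasMultiplicativeReductionAtPrime 3) (haK : ∀ ℓ : ℕ, VK.LFunction ℓ = W.LFunction ℓ) :
    ¬ (3 : ℤ) ∣ D.c := by
  have hwit : ThreeAdicPolarWitness W VK D.f :=
    threeAdicPolarWitness_katoCurve_of_degeneracyNinePlusIndex W D hadd hopt h9 hsq hd hpd VK hiso hK hnewK hgK hmK haK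
  have hFact : KatoFactThreeAt VK D.f := hF VK D.f hK
  have hΩ : W.realPeriodRat = ((|D.c| : ℤ) : ℝ) * plusPeriod D.f := by
    rw [Int.cast_abs]; exact D.realPeriodRat_eq_abs_mul_plusPeriod_of_latticeEq hopt
  have hc0 : D.c ≠ 0 := D.maninConstant_ne_zero_holds
  have h := not_three_dvd_of_katoFactThreeAt_of_witness W VK D.f |D.c| hFact hwit hΩ (abs_ne_zero.mpr hc0)
  exact fun h3 ↦ h ((dvd_abs 3 D.c).mpr h3)

/-- **The same from the lattice law E-es-68₉ and the Shimura plus index** (`PlusIndexPrimeTo 3 D.f`). CONDITIONAL.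
[cite: Kato2004Asterisque, Thm. 12.5 (1) (p. 221)] -/
theorem not_three_dvd_maninConstant_of_degeneracyLoopLawNine_symbolClosure (h68 : DegeneracyLoopLawNine)
    (hF : kato_isIntegral_twistedSymbolSum_three_symbolClosure)
    (W : WeierstrassCurve ℚ) [W.IsElliptic] [W.IsGloballyMinimal] {N : ℕ} [NeZero N] (D : ModularParametrizationData W N)
    (hadd : ¬ W.HasGoodReductionAtPrime 3 ∧ ¬ W.HasMultiplicativeReductionAtPrime 3)
    (hopt : ∀ z ∈ D.L.lattice, ∃ w ∈ periodLattice D.f, z = D.c * w)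
    (h9 : 3 ^ 2 ∣ N) (hsq : ∀ ℓ ∈ N.primeFactors, ℓ ^ 2 ∣ N) (hpi : PlusIndexPrimeTo 3 D.f)
    (hpd : CuspidalPlusDefectPrimeTo 3 D)
    (VK : WeierstrassCurve ℚ) [VK.IsElliptic] [VK.IsGloballyMinimal] (hiso : WeierstrassCurve.IsIsogenous W VK)
    (hK : IsSymbolClosureCurve VK D.f) (hnewK : IsNewformOf VK D.f) (hgK : ¬ VK.HasGoodReductionAtPrime 3)
    (hmK : ¬ VK.HasMultiplicativeReductionAtPrime 3) (haK : ∀ ℓ : ℕ, VK.LFunction ℓ = W.LFunction ℓ) :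
    ¬ (3 : ℤ) ∣ D.c :=
  not_three_dvd_maninConstant_of_degeneracyNinePlusIndex_symbolClosure hF W D hadd hopt h9 hsq
    (fun x hx ↦ by
      obtain ⟨y, hy, k, hk, hxy⟩ := hpi x hx
      exact ⟨y, by rw [h68 h9 D.f]; exact hy, k, hk, hxy⟩)
    hpd VK hiso hK hnewK hgK hmK haK

/-- **Composite squarefull variant**: a second additive prime `q ≠ 3`, `q² ∣ N`, discharges the Shimura plus index by the tree's
Hecke sieve (`plusIndexPrimeTo_three_of_sq_dvd`). CONDITIONAL on F-es-18♭K + E-es-68₉. [cite: Kato2004Asterisque, Thm. 12.5 (1) (p. 221)] -/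
theorem not_three_dvd_maninConstant_of_degeneracyLoopLawNine_symbolClosure' (h68 : DegeneracyLoopLawNine)
    (hF : kato_isIntegral_twistedSymbolSum_three_symbolClosure)
    (W : WeierstrassCurve ℚ) [W.IsElliptic] [W.IsGloballyMinimal] {N : ℕ} [NeZero N] (D : ModularParametrizationData W N)
    (hadd : ¬ W.HasGoodReductionAtPrime 3 ∧ ¬ W.HasMultiplicativeReductionAtPrime 3)
    (hopt : ∀ z ∈ D.L.lattice, ∃ w ∈ periodLattice D.f, z = D.c * w)
    (h9 : 3 ^ 2 ∣ N) (hsq : ∀ ℓ ∈ N.primeFactors, ℓ ^ 2 ∣ N) {q : ℕ} (hq : q.Prime) (hq3 : q ≠ 3) (hqN : q ^ 2 ∣ N)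
    (hpd : CuspidalPlusDefectPrimeTo 3 D)
    (VK : WeierstrassCurve ℚ) [VK.IsElliptic] [VK.IsGloballyMinimal] (hiso : WeierstrassCurve.IsIsogenous W VK)
    (hK : IsSymbolClosureCurve VK D.f) (hnewK : IsNewformOf VK D.f) (hgK : ¬ VK.HasGoodReductionAtPrime 3)
    (hmK : ¬ VK.HasMultiplicativeReductionAtPrime 3) (haK : ∀ ℓ : ℕ, VK.LFunction ℓ = W.LFunction ℓ) :
    ¬ (3 : ℤ) ∣ D.c :=
  not_three_dvd_maninConstant_of_degeneracyLoopLawNine_symbolClosure h68 hF W D hadd hopt h9 hsq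
    (plusIndexPrimeTo_three_of_sq_dvd D hq hq3 hqN) hpd VK hiso hK hnewK hgK hmK haK

end Summit.BirchSwinnertonDyer.BirchSwinnertonDyer.Theorems.ManinLocalTwoThree

end
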